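/-
Copyright: statement-level skeleton of a published paper (lit-balaban cell, Phase-2 proof seat p32 gen 45). No claims beyond
what the kernel checks below.
-/
import Literature.MathematicalPhysics.QuantumFieldTheory.Balaban1983to89.B3GraphIso

/-!
# B3 — T. Bałaban, *(Higgs)₂,₃ quantum fields in a finite volume. III. Renormalization*, CMP **88** (1983) 411–445
[Balaban1983Higgs3] — p. 415 [PDF 5] (1.17) «graph … in the usual sense» / p. 416 [PDF 6] (1.21)–(1.22) «combinatoric
factors»: RELABELLING THE VERTICES OF A GRAPH OF THE MODEL — an isomorphism is its vertex bijection (so two graphs have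
finitely many isomorphisms), the automorphism GROUP of a graph (its order divides V!), the transport of a graph along a
bijection onto its vertices (`relabel`; `H ≅ G` iff `H` is a relabelling of `G`), the ACTION of the permutations of the `V`
labels on the graphs with `V` vertices, orbits = isomorphism classes, stabilizer ≃ automorphisms, and ORBIT–STABILIZER:
(number of graphs on the `V` labelled vertices isomorphic to `G`) · (number of automorphisms of `G`) = V!, and the CLASS
FORMULA (number of graphs on the `V` labelled vertices) = Σ over the isomorphism classes of V!/|Aut| and BURNSIDE'S COUNT
(number of classes) · V! = Σ_σ (number of labelled graphs fixed by σ) — for the graphs of the model and, in `§6`, for the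
two-leg insertions (the letters of (1.21))

statement-level skeleton of published theorems with citation tags; proofs where landed; nothing here is a claim about
the Yang–Mills mass gap

PDF held: `paper:balaban1983-higgs-2-3-quantum-fields-finite-volume` (journal page = PDF page + 410); pp. 415–416 read as
images this session on the ×2 renders `run/shared/lean/pub/pub-balaban/b2b-balaban-ref1/pages/1983-cmp88-higgs23-III/
1983-cmp88-higgs23-III-p005-x2.png` / `…-p006-x2.png`.

CITATION HEADER (lean-in-tree rule).  lit-balaban TYPED SKELETON (HOME `run/shared/lean/pub/lit-balaban/`), PHASE 2, seat p32
gen 45 (unit `lit-balaban-p32`; TAKING line HOME/STATUS.md 2026-08-24T13:24:00Z + scope-split line at the filing of FILE 1,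
free-target protocol G.5-34(d)), rows **B3.Eq1.17-1.18** («graph», p. 415) and **B3.Eq1.19-1.22** ((1.21)–(1.22), p. 416) of
`HOME/lit-balaban-r15/ROWS-B3.md` (fold owner r15; both heads `proved`; this file is an OPTIONAL located member, zero head
weight).  FILE 2 of 2 of the item «finiteness and relabelling at fixed order» (FILE 1 `B3GraphFiniteOrder`: finitely many
graphs with a given number of vertices; the two files are independent).  CONSUMES BY NAME: p18's model `B3Cor23Concrete.Graph`
/ `Leg` (p. 415), p37's `B3GraphGlueLegs.fibreCast` and `B3OnePIChainGlue.TwoLegGraph`, p32 gen 44's `B3GraphIso.leg_ext` /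
`legOf` (+ `legOf_legOf`, `legOf_congr`, `legOf_symm_legOf`, `legOf_legOf_symm`, `isLeft_legOf`) / `GraphIso` (+ `refl`,
`symm`, `trans`, `legMap`, `legInv`, `other_legMap`) / `TwoLegGraphIso`; Mathlib's `MulAction.orbit` / `stabilizer`,
`MulAction.index_stabilizer`, `Subgroup.index_mul_card`, `Subgroup.card_dvd_of_injective`, `MulAction.selfEquivSigmaOrbits` (class
formula), `MulAction.sum_card_fixedBy_eq_card_orbits_mul_card_group` (Burnside).  Nothing re-declared; no
declaration is added to another file's namespace (`relabel`, `GraphOn`, the instances live here).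

THE PRINTED TEXT (verbatim).  p. 415: *"Now a graph for us is a collection of internal lines, external legs, and vertices
connected in the usual sense. There is at least one internal line, and every internal line has a vertex at each endpoint.
The construction of graphs is otherwise arbitrary."*  p. 416, after (1.22): *"Here we did not write, and we will not write
in the future, combinatoric factors before the graphs, understanding that they are a part of the graphical description."*

KIND «(ours)» (G.5-54): print takes graphs *"in the usual sense"* — up to a renaming of the vertices — while p18's carrier
labels the vertices by `Fin nV`; this file is the dictionary between the two (a graph "in the usual sense" with `V` vertices =
an orbit of the relabelling action on the graphs with vertex labels `0, …, V−1`) and the one combinatorial identity it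
supports, orbit–stabilizer, which is what makes a *"combinatoric factor"* of an unlabelled graph a definite number
(`V!/|Aut G|` labelled copies).  Print states neither; provenance is claimed only for the two sentences quoted above.

WHAT IS PROVED (theorems + `def`/`abbrev`/`instance` plumbing with bodies; no `Prop` fact, no `sorry`; standard axioms).
* `§1` **`graphIso_ext`** (an isomorphism is determined by its vertex bijection), `toEquiv_injective`, `nV_eq_of_graphIso`,
  **`finite_graphIso : Finite (GraphIso G H)`**, `card_graphIso_self_pos`; `twoLegGraphIso_ext`,
  **`finite_twoLegGraphIso`**, `card_twoLegGraphIso_self_pos`.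
* `§2` **`autGroup : Group (GraphIso G G)`** (`aut_mul_def` / `aut_one_def` / `aut_inv_def`), **`autToPerm : GraphIso G G →*
  Equiv.Perm (Fin G.nV)`**, `autToPerm_injective`, **`card_aut_dvd_factorial : Nat.card (GraphIso G G) ∣ (G.nV)!`**,
  `card_aut_le_factorial`; **`autCongr (e : GraphIso G H) : GraphIso G G ≃* GraphIso H H`** (conjugation) ⇒
  **`card_aut_eq_of_iso`** (the symmetry number is a class invariant).
* `§3` **`graph_eq`**: an extensionality principle for p18's `Graph` along a cast of the vertex labels.
* `§4` **`relabel G σ`** (σ : Fin n ≃ Fin G.nV), `relabel_nV` / `relabel_kind` / `relabel_other`, **`isoRelabel :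
  GraphIso (relabel G σ) G`**, **`relabel_eq_of_iso (e : GraphIso H G) : relabel G e.toEquiv = H`** (an isomorphism IS a
  relabelling), `relabel_refl`, `relabel_finCongr`, **`relabel_relabel`** (relabellings compose), `relabel_finCongr_trans_iso`.
* `§5` `GraphOn n̄ V := {G // G.nV = V}`, **`permMulAction : MulAction (Equiv.Perm (Fin V)) (GraphOn n̄ V)`** (`smul_val`),
  **`mem_orbit_iff_nonempty_graphIso`** / `orbit_eq_setOf_iso` (orbits = isomorphism classes), `isConnected_smul_iff` /
  `isOnePI_smul_iff` / `isProper_smul_iff` / `numExtLegs_smul` (the class predicates are constant on orbits), `mem_stabilizer_iff'`,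
  `autOfStabilizer` (+ `toEquiv_autOfStabilizer_apply`, `_injective`, `_surjective`, `_mul`), **`stabilizerEquivAut :
  stabilizer ≃ GraphIso G G`**, `card_stabilizer_eq_card_aut`, **`stabilizerMulEquivAut : stabilizer ≃* GraphIso G G`** (a
  GROUP isomorphism, via `σ ↦ (autOfStabilizer G σ)⁻¹`), **`ncard_iso_mul_card_aut`**:
  `{H | Nonempty (GraphIso H.1 G.1)}.ncard * Nat.card (GraphIso G.1 G.1) = V!`, `finite_setOf_iso`,
  `ncard_iso_eq_factorial_div` (the labelled count of a class is `V!/|Aut G|`), `ncard_iso_dvd_factorial`; `IsoClassOn n̄ V` (the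
  orbit quotient = isomorphism classes on `V` vertices, `isoClassOn_mk_eq_iff`), `finite_isoClassOn` and the CLASS FORMULA
  **`card_graphOn_eq_finsum_classes`**: `Nat.card {G // G.nV = V} = ∑ᶠ c, V! / |Aut c|` — both under the instance hypothesis
  `[Finite {G // G.nV = V}]`, which is FILE 1's `B3GraphFiniteOrder.finite_graph_nV_eq` (not imported: the two files are independent);
  `mem_fixedBy_iff` and BURNSIDE'S COUNT **`card_isoClassOn_mul_factorial`**: `#classes · V! = Σ_σ #{labelled graphs fixed by σ}`.
* `§6` the same for the TWO-LEG INSERTIONS of (1.21) (p37's `TwoLegGraph`, isomorphisms `TwoLegGraphIso` keeping the in-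
  and out-leg): `twoLeg_eq` (extensionality), `legOf_heq_of_codomain_eq`, **`relabelTL T σ`**, **`isoRelabelTL`**,
  **`relabelTL_eq_of_iso`**, `relabelTL_relabelTL`, `relabelTL_finCongr_trans_iso`, `TwoLegOn n̄ V`, **`permMulActionTL`**
  (`smul_val_TL`), **`mem_orbit_iff_nonempty_twoLegGraphIso`** / `orbit_eq_setOf_isoTL`, `isConnected_smul_iff_TL` /
  `isOnePI_smul_iff_TL` / `numSep_smul_TL` (C_n, 1PI and the piece count are constant on orbits), `mem_stabilizer_iff_TL`,
  `autOfStabilizerTL` (+ `toEquiv_autOfStabilizerTL_apply`, `_injective`, `_surjective`, `_mul`), **`stabilizerEquivAutTL`**,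
  `autGroupTL : Group (TwoLegGraphIso T T)` (`autTL_mul_def`), `autTLToAut : Aut T →* Aut T.G` (injective;
  **`card_autTL_dvd_card_aut`**, `card_autTL_dvd_factorial`), `autCongrTL` ⇒ **`card_autTL_eq_of_iso`**,
  **`stabilizerMulEquivAutTL`** (group isomorphism),
  **`ncard_isoTL_mul_card_aut`** (orbit–stabilizer for insertions), `ncard_isoTL_eq_factorial_div`, `ncard_isoTL_dvd_factorial`,
  `IsoClassOnTL`, `finite_isoClassOnTL`, **`card_twoLegOn_eq_finsum_classes`** (class formula for insertions, under `[Finite {T // T.G.nV = V}]`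
  = FILE 1's `finite_twoLeg_nV_eq`), `mem_fixedBy_iff_TL`, **`card_isoClassOnTL_mul_factorial`** (Burnside for insertions).

HONEST SCOPE.  (i) Isomorphisms are the RIGID ones of `B3GraphIso` (leg slots kept): a symmetric permutation of the legs of
one vertex (e.g. of the four φ′-legs of (1.6)) is not an automorphism here, so `|Aut G|` is the vertex-relabelling symmetry
number only; print's implicit combinatoric factors also absorb leg permutations and the 1/n! of the exponential series — NOT
defined or derived here (no amplitude is attached; the Feynman-rule side is p26's / p33's).  (ii) The action is on the graphs
with a FIXED number `V` of vertices (all isomorphic graphs have the same `V`, `nV_eq_of_graphIso`); the stabilizer is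
identified with the automorphism GROUP (`stabilizerMulEquivAut`, `stabilizerMulEquivAutTL`).  (iii) The
isomorphism classes here are orbits INSIDE the graphs (insertions) with `V` labelled vertices; the identification with the
quotient types of p32 gen 44's `B3OnePIChainClasses` (`IsoClass`, pending p371408) is by `mem_orbit_iff_nonempty_*` and is
not spelled out (that file is not imported).  (iv) Nothing analytic; no amplitude is attached (the invariance of the
amplitude under isomorphisms is p37's `B3GraphIsoAmplitude.graphAmp_iso` ∕ `kernel_pull`, not imported here; combined with
`mem_orbit_iff_nonempty_graphIso` it makes the amplitude a function on the orbits).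
-/

namespace Literature.MathematicalPhysics.QuantumFieldTheory.Balaban1983to89.B3GraphRelabelling

open B3Prop1 B3Cor23Concrete B3GraphGlueLegs B3OnePIChainGlue B3GraphIso

variable {nbar : ℕ}

/-! ## §1 An isomorphism is its vertex bijection; finitely many isomorphisms -/

section Iso

variable {G H : Graph nbar} {T T' : TwoLegGraph nbar}

/-- kernel: **an isomorphism of graphs of the model is determined by its vertex bijection** (the leg map is induced, the
other two fields are conditions). [cite: Balaban1983Higgs3, p.415] -/
theorem graphIso_ext {e e' : GraphIso G H} (h : e.toEquiv = e'.toEquiv) : e = e' := by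
  cases e
  cases e'
  cases h
  rfl

/-- kernel: the vertex-bijection map of isomorphisms is injective. [cite: Balaban1983Higgs3, p.415] -/
theorem toEquiv_injective : Function.Injective (GraphIso.toEquiv : GraphIso G H → Fin G.nV ≃ Fin H.nV) :=
  fun _ _ h => graphIso_ext h

/-- kernel: isomorphic graphs have the same number of vertices. [cite: Balaban1983Higgs3, p.415] -/
theorem nV_eq_of_graphIso (e : GraphIso G H) : G.nV = H.nV := by
  simpa using Fintype.card_congr e.toEquiv

/-- **Two graphs of the model have finitely many isomorphisms between them**; in particular every graph has a finite set
of automorphisms. [cite: Balaban1983Higgs3, p.415] -/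
instance finite_graphIso (G H : Graph nbar) : Finite (GraphIso G H) :=
  Finite.of_injective (fun e : GraphIso G H => (e.toEquiv : Fin G.nV → Fin H.nV))
    fun _ _ h => graphIso_ext (Equiv.coe_fn_injective h)

/-- kernel: the automorphisms of a graph form a finite, nonempty set (the identity is one). [cite: Balaban1983Higgs3, p.415] -/
theorem card_graphIso_self_pos (G : Graph nbar) : 0 < Nat.card (GraphIso G G) :=
  Nat.card_pos_iff.mpr ⟨⟨GraphIso.refl G⟩, inferInstance⟩

/-- kernel: **an isomorphism of two-leg insertions is determined by its underlying graph isomorphism.**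
[cite: Balaban1983Higgs3, (1.21) p.416] -/
theorem twoLegGraphIso_ext {e e' : TwoLegGraphIso T T'} (h : e.toGraphIso = e'.toGraphIso) : e = e' := by
  cases e
  cases e'
  cases h
  rfl

/-- **Two two-leg insertions have finitely many isomorphisms between them.** [cite: Balaban1983Higgs3, (1.21) p.416] -/
instance finite_twoLegGraphIso (T T' : TwoLegGraph nbar) : Finite (TwoLegGraphIso T T') :=
  Finite.of_injective TwoLegGraphIso.toGraphIso fun _ _ h => twoLegGraphIso_ext h

/-- kernel: the automorphisms of a two-leg insertion form a finite, nonempty set. [cite: Balaban1983Higgs3, (1.21) p.416] -/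
theorem card_twoLegGraphIso_self_pos (T : TwoLegGraph nbar) : 0 < Nat.card (TwoLegGraphIso T T) :=
  Nat.card_pos_iff.mpr ⟨⟨TwoLegGraphIso.refl T⟩, inferInstance⟩

/-! ## §2 The automorphism group of a graph of the model -/

/-- **The automorphisms of a graph of the model form a group** under composition («(ours)»: `e * e'` = first `e'`, then `e`;
unit `GraphIso.refl`, inverse `GraphIso.symm`) — the rigid symmetry group whose order is the denominator of a symmetry
factor (print, p. 416: *"we did not write, and we will not write in the future, combinatoric factors before the graphs,
understanding that they are a part of the graphical description"*; no factor is defined here).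
[cite: Balaban1983Higgs3, (1.21)–(1.22) p.416] -/
instance autGroup (G : Graph nbar) : Group (GraphIso G G) where
  mul e e' := e'.trans e
  one := GraphIso.refl G
  inv := GraphIso.symm
  mul_assoc a b c := graphIso_ext (Equiv.ext fun _ => rfl)
  one_mul a := graphIso_ext (Equiv.ext fun _ => rfl)
  mul_one a := graphIso_ext (Equiv.ext fun _ => rfl)
  inv_mul_cancel a := graphIso_ext (Equiv.ext fun v => by
    show a.toEquiv.symm (a.toEquiv v) = v
    exact a.toEquiv.symm_apply_apply v)

/-- kernel: the product of automorphisms is composition (first the right factor). [cite: Balaban1983Higgs3, (1.21)–(1.22) p.416] -/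
theorem aut_mul_def (e e' : GraphIso G G) : e * e' = e'.trans e := rfl

/-- kernel: the unit is the identity isomorphism. [cite: Balaban1983Higgs3, (1.21)–(1.22) p.416] -/
theorem aut_one_def (G : Graph nbar) : (1 : GraphIso G G) = GraphIso.refl G := rfl

/-- kernel: the inverse is the inverse isomorphism. [cite: Balaban1983Higgs3, (1.21)–(1.22) p.416] -/
theorem aut_inv_def (e : GraphIso G G) : e⁻¹ = e.symm := rfl

/-- The automorphism group as a group of permutations of the vertices («(ours)»): the vertex-bijection map is a group
homomorphism into `Equiv.Perm (Fin G.nV)`. [cite: Balaban1983Higgs3, (1.21)–(1.22) p.416] -/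
def autToPerm (G : Graph nbar) : GraphIso G G →* Equiv.Perm (Fin G.nV) where
  toFun e := e.toEquiv
  map_one' := rfl
  map_mul' _ _ := rfl

/-- kernel: `autToPerm` is injective — an automorphism is its vertex permutation. [cite: Balaban1983Higgs3, (1.21)–(1.22) p.416] -/
theorem autToPerm_injective (G : Graph nbar) : Function.Injective (autToPerm G) :=
  fun _ _ h => graphIso_ext h

/-- **The order of the automorphism group of a graph with `V` vertices divides `V!`** (it embeds in the permutations of
the vertices). [cite: Balaban1983Higgs3, (1.21)–(1.22) p.416] -/
theorem card_aut_dvd_factorial (G : Graph nbar) : Nat.card (GraphIso G G) ∣ (G.nV).factorial := by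
  have h := Subgroup.card_dvd_of_injective (autToPerm G) (autToPerm_injective G)
  rwa [Nat.card_eq_fintype_card (α := Equiv.Perm (Fin G.nV)), Fintype.card_perm, Fintype.card_fin] at h

/-- kernel: in particular a graph with `V` vertices has at most `V!` automorphisms. [cite: Balaban1983Higgs3, (1.21)–(1.22) p.416] -/
theorem card_aut_le_factorial (G : Graph nbar) : Nat.card (GraphIso G G) ≤ (G.nV).factorial :=
  Nat.le_of_dvd (Nat.factorial_pos _) (card_aut_dvd_factorial G)

/-- **Isomorphic graphs have isomorphic automorphism groups** («(ours)»): conjugation by an isomorphism `e : G ≅ H`,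
`a ↦ e⁻¹ ≫ a ≫ e`. [cite: Balaban1983Higgs3, (1.21)–(1.22) p.416] -/
def autCongr (e : GraphIso G H) : GraphIso G G ≃* GraphIso H H where
  toFun a := (e.symm.trans a).trans e
  invFun b := (e.trans b).trans e.symm
  left_inv a := graphIso_ext (Equiv.ext fun v => by simp)
  right_inv b := graphIso_ext (Equiv.ext fun w => by simp)
  map_mul' a b := graphIso_ext (Equiv.ext fun w => by simp [aut_mul_def])

/-- kernel: the vertex bijection of a conjugated automorphism. [cite: Balaban1983Higgs3, (1.21)–(1.22) p.416] -/
theorem toEquiv_autCongr_apply (e : GraphIso G H) (a : GraphIso G G) (w : Fin H.nV) :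
    (autCongr e a).toEquiv w = e.toEquiv (a.toEquiv (e.toEquiv.symm w)) := by
  simp [autCongr]

/-- **The symmetry number is an invariant of the isomorphism class**: isomorphic graphs have the same number of
automorphisms. [cite: Balaban1983Higgs3, (1.21)–(1.22) p.416] -/
theorem card_aut_eq_of_iso (e : GraphIso G H) : Nat.card (GraphIso G G) = Nat.card (GraphIso H H) :=
  Nat.card_congr (autCongr e).toEquiv

end Iso

/-! ## §3 An extensionality principle for graphs of the model -/

/-- kernel («(ours)», plumbing): **two graphs of the model are EQUAL** once they have the same number of vertices, the same
kinds along the cast of vertex labels, and «other endpoint» maps that correspond along the induced leg map — p18's `Graph`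
has no further data (its remaining fields are conditions). [cite: Balaban1983Higgs3, p.415] -/
theorem graph_eq {G H : Graph nbar} (hn : G.nV = H.nV) (hk : ∀ i, H.kind (Fin.cast hn i) = G.kind i)
    (ho : ∀ x, H.other (legOf (Fin.cast hn) hk x) = (G.other x).map (legOf (Fin.cast hn) hk)) : G = H := by
  obtain ⟨n, k, a, o, o₁, o₂, o₃, o₄⟩ := G
  obtain ⟨n', k', a', o', o₁', o₂', o₃', o₄'⟩ := H
  dsimp only at hn hk ho
  subst hn
  have hk' : k' = k := funext fun i => hk i
  subst hk'
  have hL : (legOf (Fin.cast (rfl : n = n)) hk : Leg k' → Leg k') = id :=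
    funext fun y => leg_ext rfl (by simp [legOf])
  rw [hL] at ho
  have ho' : o = o' := funext fun x => by simpa using (ho x).symm
  subst ho'
  rfl

/-! ## §4 Transport of a graph along a bijection onto its vertices -/

section Relabel

variable {n m : ℕ}

/-- kernel (plumbing): along `σ : Fin n ≃ Fin G.nV`, the kinds read through `σ` agree with `G`'s at `σ.symm w`.
[cite: Balaban1983Higgs3, p.415] -/
theorem kind_apply_symm (G : Graph nbar) (σ : Fin n ≃ Fin G.nV) (w : Fin G.nV) :
    (fun i => G.kind (σ i)) (σ.symm w) = G.kind w :=
  congrArg G.kind (σ.apply_symm_apply w)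

/-- **The graph `G` with its vertices RELABELLED along a bijection `σ : Fin n ≃ Fin G.nV`** («(ours)»): vertex `i` of the
new graph is vertex `σ i` of `G` (same catalogue kind), and the line through a leg is the line of `G` through the
corresponding leg, read back along `σ⁻¹` — the same graph *"in the usual sense"* (p. 415) on new labels.
[cite: Balaban1983Higgs3, p.415] -/
@[reducible] def relabel (G : Graph nbar) (σ : Fin n ≃ Fin G.nV) : Graph nbar where
  nV := n
  kind i := G.kind (σ i)
  adm i := G.adm (σ i)
  other x := (G.other (legOf σ (kG := fun i => G.kind (σ i)) (fun _ => rfl) x)).map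
    (legOf σ.symm (kind_apply_symm G σ))
  other_ne x y h := by
    obtain ⟨z, hz, rfl⟩ := Option.map_eq_some_iff.mp h
    intro hzx
    apply G.other_ne _ _ hz
    rw [← hzx, legOf_legOf_symm]
  other_symm x y h := by
    obtain ⟨z, hz, rfl⟩ := Option.map_eq_some_iff.mp h
    rw [legOf_legOf_symm, G.other_symm _ _ hz, Option.map_some, legOf_symm_legOf]
  other_isLeft x y h := by
    obtain ⟨z, hz, rfl⟩ := Option.map_eq_some_iff.mp h
    have h' := G.other_isLeft _ _ hz
    rw [isLeft_legOf] at h'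
    rw [isLeft_legOf, h']
  exists_line := by
    obtain ⟨w, hw⟩ := G.exists_line
    exact ⟨legOf σ.symm (kind_apply_symm G σ) w, by rw [legOf_legOf_symm]; simpa using hw⟩

/-- kernel: the relabelled graph has `n` vertices. [cite: Balaban1983Higgs3, p.415] -/
@[simp] theorem relabel_nV (G : Graph nbar) (σ : Fin n ≃ Fin G.nV) : (relabel G σ).nV = n := rfl

/-- kernel: the kinds of the relabelled graph. [cite: Balaban1983Higgs3, p.415] -/
@[simp] theorem relabel_kind (G : Graph nbar) (σ : Fin n ≃ Fin G.nV) (i : Fin n) : (relabel G σ).kind i = G.kind (σ i) := rfl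

/-- kernel: the «other endpoint» map of the relabelled graph. [cite: Balaban1983Higgs3, p.415] -/
theorem relabel_other (G : Graph nbar) (σ : Fin n ≃ Fin G.nV) (x : Leg (relabel G σ).kind) :
    (relabel G σ).other x = (G.other (legOf σ (kH := G.kind) (fun _ => rfl) x)).map (legOf σ.symm (kind_apply_symm G σ)) :=
  rfl

/-- **The relabelled graph is isomorphic to the original**, by `σ` itself. [cite: Balaban1983Higgs3, p.415] -/
def isoRelabel (G : Graph nbar) (σ : Fin n ≃ Fin G.nV) : GraphIso (relabel G σ) G where
  toEquiv := σ
  kind_eq _ := rfl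
  map_other x := by
    rw [relabel_other, Option.map_map]
    have h : (legOf σ (kH := G.kind) (fun _ => rfl) ∘ legOf σ.symm (kind_apply_symm G σ)) = id :=
      funext fun y => legOf_legOf_symm σ _ _ y
    rw [h, Option.map_id, id]

/-- kernel: the vertex map of `isoRelabel` is `σ`. [cite: Balaban1983Higgs3, p.415] -/
@[simp] theorem toEquiv_isoRelabel (G : Graph nbar) (σ : Fin n ≃ Fin G.nV) : (isoRelabel G σ).toEquiv = σ := rfl

/-- **An isomorphism `e : H ≅ G` IS a relabelling: `G` relabelled along `e`'s vertex bijection is `H` itself** — the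
converse of `isoRelabel`; together: `H ≅ G` iff `H` is a relabelling of `G`. [cite: Balaban1983Higgs3, p.415] -/
theorem relabel_eq_of_iso {G H : Graph nbar} (e : GraphIso H G) : relabel G e.toEquiv = H := by
  refine graph_eq rfl (fun i => (e.kind_eq i).symm) fun x => ?_
  have hC : (legOf (Fin.cast (rfl : (relabel G e.toEquiv).nV = H.nV)) (fun i => (e.kind_eq i).symm) :
      Leg (relabel G e.toEquiv).kind → Leg H.kind) =
        e.legInv ∘ legOf e.toEquiv (kG := (relabel G e.toEquiv).kind) (kH := G.kind) (fun _ => rfl) := by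
    funext y
    show _ = legOf e.toEquiv.symm e.kind_eq_symm (legOf e.toEquiv _ y)
    rw [legOf_legOf]
    exact legOf_congr _ _ (fun v => (e.toEquiv.symm_apply_apply v).symm) _
  have hC' : (e.legInv ∘ legOf e.toEquiv (kG := (relabel G e.toEquiv).kind) (kH := G.kind) (fun _ => rfl)) ∘
      legOf e.toEquiv.symm (kG := G.kind) (kH := (relabel G e.toEquiv).kind) (kind_apply_symm G e.toEquiv) =
        e.legInv := by
    funext z
    show e.legInv (legOf _ _ (legOf _ _ z)) = _
    rw [legOf_legOf_symm]
  rw [hC, relabel_other, Option.map_map, hC', Function.comp_apply, ← GraphIso.legMap_symm]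
  exact GraphIso.other_legMap e.symm _

/-- kernel: relabelling along the identity does nothing. [cite: Balaban1983Higgs3, p.415] -/
theorem relabel_refl (G : Graph nbar) : relabel G (Equiv.refl (Fin G.nV)) = G :=
  relabel_eq_of_iso (GraphIso.refl G)

/-- kernel: relabelling along a cast `Fin V ≃ Fin G.nV` (same labels, `V = G.nV`) does nothing. [cite: Balaban1983Higgs3, p.415] -/
theorem relabel_finCongr (G : Graph nbar) {V : ℕ} (h : V = G.nV) : relabel G (finCongr h) = G := by
  subst h
  have : finCongr (rfl : G.nV = G.nV) = Equiv.refl _ := Equiv.ext fun i => by simp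
  rw [this]
  exact relabel_refl G

/-- kernel: **relabellings compose** — relabelling along `σ` and then along `τ` is relabelling along `τ.trans σ`.
[cite: Balaban1983Higgs3, p.415] -/
theorem relabel_relabel (G : Graph nbar) (σ : Fin n ≃ Fin G.nV) (τ : Fin m ≃ Fin n) :
    relabel (relabel G σ) τ = relabel G (τ.trans σ) := by
  have he : ((isoRelabel G (τ.trans σ)).trans (isoRelabel G σ).symm).toEquiv = τ :=
    Equiv.ext fun i => by simp
  have h := relabel_eq_of_iso ((isoRelabel G (τ.trans σ)).trans (isoRelabel G σ).symm)
  rwa [he] at h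

/-- kernel: **relabelling along a cast followed by an isomorphism's vertex bijection** gives the isomorphic graph back
(the form in which the orbit computations below use `relabel_eq_of_iso`). [cite: Balaban1983Higgs3, p.415] -/
theorem relabel_finCongr_trans_iso {G H : Graph nbar} (e : GraphIso H G) {V : ℕ} (h : V = H.nV) :
    relabel G ((finCongr h).trans e.toEquiv) = H := by
  subst h
  have : (finCongr (rfl : H.nV = H.nV)).trans e.toEquiv = e.toEquiv := Equiv.ext fun i => by simp
  rw [this]
  exact relabel_eq_of_iso e

end Relabel

/-! ## §5 Permuting the labels of the graphs with `V` vertices: orbits = isomorphism classes, ORBIT–STABILIZER -/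

section Action

variable {V : ℕ}

/-- The graphs of the model with exactly `V` vertices («(ours)», the carrier of the action). [cite: Balaban1983Higgs3, p.415] -/
abbrev GraphOn (nbar V : ℕ) : Type := {G : Graph nbar // G.nV = V}

/-- **The action of the permutations of `V` labels on the graphs with `V` vertices** («(ours)»): `σ • G` is `G`
relabelled so that the vertex labelled `v` in `G` is labelled `σ v` in `σ • G` (transport along `σ⁻¹`, composed with the
cast `Fin V ≃ Fin G.nV`). [cite: Balaban1983Higgs3, p.415] -/
instance permSMul (nbar V : ℕ) : SMul (Equiv.Perm (Fin V)) (GraphOn nbar V) :=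
  ⟨fun σ G => ⟨relabel G.1 (σ.symm.trans (finCongr G.2.symm)), rfl⟩⟩

/-- kernel: the graph underlying `σ • G`. [cite: Balaban1983Higgs3, p.415] -/
theorem smul_val (σ : Equiv.Perm (Fin V)) (G : GraphOn nbar V) :
    (σ • G).1 = relabel G.1 (σ.symm.trans (finCongr G.2.symm)) := rfl

/-- **The permutations of the labels ACT on the graphs with `V` vertices** (a group action: `1 • G = G`,
`(σ * τ) • G = σ • (τ • G)`). [cite: Balaban1983Higgs3, p.415] -/
instance permMulAction (nbar V : ℕ) : MulAction (Equiv.Perm (Fin V)) (GraphOn nbar V) where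
  one_smul G := by
    apply Subtype.ext
    rw [smul_val]
    have h : ((1 : Equiv.Perm (Fin V)).symm.trans (finCongr G.2.symm)) = finCongr G.2.symm := Equiv.ext fun _ => rfl
    rw [h]
    exact relabel_finCongr G.1 G.2.symm
  mul_smul σ τ G := by
    apply Subtype.ext
    show relabel G.1 ((σ * τ).symm.trans (finCongr G.2.symm)) =
      relabel (relabel G.1 (τ.symm.trans (finCongr G.2.symm))) (σ.symm.trans (finCongr rfl))
    rw [relabel_relabel]
    exact congrArg (relabel G.1) (Equiv.ext fun v => rfl)

/-- **The orbit of `G` under relabelling is its isomorphism class**: `H` is a relabelling of `G` iff `H ≅ G`.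
[cite: Balaban1983Higgs3, p.415] -/
theorem mem_orbit_iff_nonempty_graphIso {G H : GraphOn nbar V} :
    H ∈ MulAction.orbit (Equiv.Perm (Fin V)) G ↔ Nonempty (GraphIso H.1 G.1) := by
  constructor
  · rintro ⟨σ, rfl⟩
    exact ⟨isoRelabel G.1 _⟩
  · rintro ⟨e⟩
    refine MulAction.mem_orbit_iff.mpr ⟨((finCongr H.2.symm).trans (e.toEquiv.trans (finCongr G.2.symm).symm)).symm, ?_⟩
    apply Subtype.ext
    rw [smul_val, Equiv.symm_symm]
    have h : (((finCongr H.2.symm).trans (e.toEquiv.trans (finCongr G.2.symm).symm)).trans (finCongr G.2.symm)) =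
        (finCongr H.2.symm).trans e.toEquiv := Equiv.ext fun v => by simp
    rw [h]
    exact relabel_finCongr_trans_iso e H.2.symm

/-- kernel: set form — the orbit of `G` is the set of graphs on `V` vertices isomorphic to `G`. [cite: Balaban1983Higgs3, p.415] -/
theorem orbit_eq_setOf_iso (G : GraphOn nbar V) :
    (MulAction.orbit (Equiv.Perm (Fin V)) G : Set (GraphOn nbar V)) = {H | Nonempty (GraphIso H.1 G.1)} :=
  Set.ext fun _ => mem_orbit_iff_nonempty_graphIso

/-- **Relabelling preserves connectedness** — the predicates singling out the classes of graphs summed over in (1.18),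
(1.21), (2.15) are constant on the orbits. [cite: Balaban1983Higgs3, p.415, (1.21) p.416] -/
theorem isConnected_smul_iff (σ : Equiv.Perm (Fin V)) (G : GraphOn nbar V) :
    B3OnePIGraphs.IsConnected (σ • G).1 ↔ B3OnePIGraphs.IsConnected G.1 :=
  ((isoRelabel G.1 (σ.symm.trans (finCongr G.2.symm))).isConnected_iff).symm

/-- kernel: relabelling preserves one-particle irreducibility. [cite: Balaban1983Higgs3, (1.21) p.416] -/
theorem isOnePI_smul_iff (σ : Equiv.Perm (Fin V)) (G : GraphOn nbar V) :
    B3OnePIGraphs.IsOnePI (σ • G).1 ↔ B3OnePIGraphs.IsOnePI G.1 :=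
  ((isoRelabel G.1 (σ.symm.trans (finCongr G.2.symm))).isOnePI_iff).symm

/-- kernel: relabelling preserves properness. [cite: Balaban1983Higgs3, (2.15) p.428] -/
theorem isProper_smul_iff (σ : Equiv.Perm (Fin V)) (G : GraphOn nbar V) :
    B3OnePIGraphs.IsProper (σ • G).1 ↔ B3OnePIGraphs.IsProper G.1 :=
  ((isoRelabel G.1 (σ.symm.trans (finCongr G.2.symm))).isProper_iff).symm

/-- kernel: relabelling preserves the number of external legs. [cite: Balaban1983Higgs3, (1.17) p.415] -/
theorem numExtLegs_smul (σ : Equiv.Perm (Fin V)) (G : GraphOn nbar V) : (σ • G).1.numExtLegs = G.1.numExtLegs :=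
  ((isoRelabel G.1 (σ.symm.trans (finCongr G.2.symm))).numExtLegs_eq).symm

/-- kernel: a permutation fixes `G` iff the corresponding relabelling of `G` is `G`. [cite: Balaban1983Higgs3, p.415] -/
theorem mem_stabilizer_iff' (G : GraphOn nbar V) (σ : Equiv.Perm (Fin V)) :
    σ ∈ MulAction.stabilizer (Equiv.Perm (Fin V)) G ↔ relabel G.1 (σ.symm.trans (finCongr G.2.symm)) = G.1 := by
  rw [MulAction.mem_stabilizer_iff, ← smul_val]
  exact ⟨fun h => congrArg Subtype.val h, fun h => Subtype.ext h⟩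

/-- kernel (plumbing): the vertex map of an isomorphism transported along an equality of its source graph.
[cite: Balaban1983Higgs3, p.415] -/
theorem toEquiv_cast_apply {A B H : Graph nbar} (h : A = B) (e : GraphIso A H) (v : Fin B.nV) :
    (cast (congrArg (fun X => GraphIso X H) h) e).toEquiv v = e.toEquiv (Fin.cast (congrArg Graph.nV h).symm v) := by
  subst h
  rfl

/-- kernel (plumbing): casting back and forth along `G.nV = V` is the identity on labels. [cite: Balaban1983Higgs3, p.415] -/
@[simp] private theorem cast_cast_symm {a b : ℕ} (h : a = b) (w : Fin b) : Fin.cast h (Fin.cast h.symm w) = w :=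
  Fin.ext rfl

/-- **The automorphism of `G` defined by a permutation fixing `G`** («(ours)»): the isomorphism `relabel G ε ≅ G`
(`isoRelabel`, `ε = σ⁻¹` read through the cast) transported along the equality `relabel G ε = G`.
[cite: Balaban1983Higgs3, (1.21)–(1.22) p.416] -/
noncomputable def autOfStabilizer (G : GraphOn nbar V) (σ : MulAction.stabilizer (Equiv.Perm (Fin V)) G) :
    GraphIso G.1 G.1 :=
  cast (congrArg (fun X => GraphIso X G.1) ((mem_stabilizer_iff' G σ.1).mp σ.2))
    (isoRelabel G.1 (σ.1.symm.trans (finCongr G.2.symm)))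

/-- kernel: the vertex map of `autOfStabilizer G σ` is `σ⁻¹` read through the cast `Fin G.nV ≃ Fin V`.
[cite: Balaban1983Higgs3, (1.21)–(1.22) p.416] -/
theorem toEquiv_autOfStabilizer_apply (G : GraphOn nbar V) (σ : MulAction.stabilizer (Equiv.Perm (Fin V)) G)
    (v : Fin G.1.nV) : (autOfStabilizer G σ).toEquiv v = Fin.cast G.2.symm (σ.1.symm (Fin.cast G.2 v)) := by
  unfold autOfStabilizer
  rw [toEquiv_cast_apply ((mem_stabilizer_iff' G σ.1).mp σ.2)]
  simp

/-- kernel: `autOfStabilizer` is injective. [cite: Balaban1983Higgs3, (1.21)–(1.22) p.416] -/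
theorem autOfStabilizer_injective (G : GraphOn nbar V) : Function.Injective (autOfStabilizer G) := by
  intro σ τ h
  apply Subtype.ext
  apply Equiv.symm_bijective.injective
  refine Equiv.ext fun w => ?_
  have hv := congrArg (fun e : GraphIso G.1 G.1 => Fin.cast G.2 (e.toEquiv (Fin.cast G.2.symm w))) h
  simpa only [toEquiv_autOfStabilizer_apply, cast_cast_symm] using hv

/-- kernel: `autOfStabilizer` is surjective — every automorphism of `G` comes from a permutation of the labels fixing `G`.
[cite: Balaban1983Higgs3, (1.21)–(1.22) p.416] -/
theorem autOfStabilizer_surjective (G : GraphOn nbar V) : Function.Surjective (autOfStabilizer G) := by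
  intro e
  let ε : Fin V ≃ Fin G.1.nV := (finCongr G.2.symm).trans e.toEquiv
  let σ : Equiv.Perm (Fin V) := (ε.trans (finCongr G.2.symm).symm).symm
  have hε : σ.symm.trans (finCongr G.2.symm) = ε := Equiv.ext fun v => by simp [σ]
  have hσ : σ ∈ MulAction.stabilizer (Equiv.Perm (Fin V)) G := by
    rw [mem_stabilizer_iff', hε]
    exact relabel_finCongr_trans_iso e G.2.symm
  refine ⟨⟨σ, hσ⟩, graphIso_ext (Equiv.ext fun v => ?_)⟩
  rw [toEquiv_autOfStabilizer_apply]
  have : σ.symm (Fin.cast G.2 v) = Fin.cast G.2 (e.toEquiv v) := by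
    simp [σ, ε]
  rw [this]
  simp

/-- **The stabilizer of `G` under relabelling is in bijection with the automorphisms of `G`.**
[cite: Balaban1983Higgs3, (1.21)–(1.22) p.416] -/
noncomputable def stabilizerEquivAut (G : GraphOn nbar V) :
    MulAction.stabilizer (Equiv.Perm (Fin V)) G ≃ GraphIso G.1 G.1 :=
  Equiv.ofBijective (autOfStabilizer G) ⟨autOfStabilizer_injective G, autOfStabilizer_surjective G⟩

/-- kernel: the stabilizer of `G` has as many elements as `G` has automorphisms. [cite: Balaban1983Higgs3, (1.21)–(1.22) p.416] -/
theorem card_stabilizer_eq_card_aut (G : GraphOn nbar V) :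
    Nat.card (MulAction.stabilizer (Equiv.Perm (Fin V)) G) = Nat.card (GraphIso G.1 G.1) :=
  Nat.card_congr (stabilizerEquivAut G)

/-- kernel: `autOfStabilizer` reverses products (it is an anti-homomorphism: `σ` acts through `σ⁻¹`).
[cite: Balaban1983Higgs3, (1.21)–(1.22) p.416] -/
theorem autOfStabilizer_mul (G : GraphOn nbar V) (σ τ : MulAction.stabilizer (Equiv.Perm (Fin V)) G) :
    autOfStabilizer G (σ * τ) = autOfStabilizer G τ * autOfStabilizer G σ := by
  refine graphIso_ext (Equiv.ext fun v => ?_)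
  rw [aut_mul_def, GraphIso.toEquiv_trans, Equiv.trans_apply, toEquiv_autOfStabilizer_apply,
    toEquiv_autOfStabilizer_apply, toEquiv_autOfStabilizer_apply, cast_cast_symm]
  simp [Equiv.Perm.mul_def]

/-- **The stabilizer of `G` under relabelling is ISOMORPHIC, as a group, to the automorphism group of `G`** (through
`σ ↦ (autOfStabilizer G σ)⁻¹`, which turns the anti-homomorphism into a homomorphism). [cite: Balaban1983Higgs3, (1.21)–(1.22) p.416] -/
noncomputable def stabilizerMulEquivAut (G : GraphOn nbar V) :
    MulAction.stabilizer (Equiv.Perm (Fin V)) G ≃* GraphIso G.1 G.1 where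
  toFun σ := (autOfStabilizer G σ)⁻¹
  invFun e := (stabilizerEquivAut G).symm e⁻¹
  left_inv σ := by
    show (stabilizerEquivAut G).symm ((stabilizerEquivAut G σ)⁻¹)⁻¹ = σ
    rw [inv_inv, Equiv.symm_apply_apply]
  right_inv e := by
    show ((stabilizerEquivAut G) ((stabilizerEquivAut G).symm e⁻¹))⁻¹ = e
    rw [Equiv.apply_symm_apply, inv_inv]
  map_mul' σ τ := by
    show (autOfStabilizer G (σ * τ))⁻¹ = (autOfStabilizer G σ)⁻¹ * (autOfStabilizer G τ)⁻¹
    rw [autOfStabilizer_mul, mul_inv_rev]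

/-- **ORBIT–STABILIZER for the graphs of the model**: the number of graphs on the `V` labelled vertices that are
isomorphic to `G`, times the number of automorphisms of `G`, is `V!` — the labelled count of an isomorphism class is
`V!/|Aut G|`, the combinatorics behind print's implicit *"combinatoric factors"* (p. 416) at the level of VERTEX labels.
[cite: Balaban1983Higgs3, (1.21)–(1.22) p.416] -/
theorem ncard_iso_mul_card_aut (G : GraphOn nbar V) :
    {H : GraphOn nbar V | Nonempty (GraphIso H.1 G.1)}.ncard * Nat.card (GraphIso G.1 G.1) = V.factorial := by
  rw [← orbit_eq_setOf_iso, ← card_stabilizer_eq_card_aut, ← MulAction.index_stabilizer (Equiv.Perm (Fin V)) G,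
    Subgroup.index_mul_card, Nat.card_eq_fintype_card, Fintype.card_perm, Fintype.card_fin]

/-- kernel: the isomorphism class of `G` among the graphs on `V` labelled vertices is a finite set (it is an orbit of a
finite group). [cite: Balaban1983Higgs3, p.415] -/
theorem finite_setOf_iso (G : GraphOn nbar V) : Set.Finite {H : GraphOn nbar V | Nonempty (GraphIso H.1 G.1)} := by
  rw [← orbit_eq_setOf_iso]
  exact Set.finite_range fun σ : Equiv.Perm (Fin V) => σ • G

/-- kernel: hence the labelled count of the isomorphism class of `G` is `V! / |Aut G|` (exact division).
[cite: Balaban1983Higgs3, (1.21)–(1.22) p.416] -/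
theorem ncard_iso_eq_factorial_div (G : GraphOn nbar V) :
    {H : GraphOn nbar V | Nonempty (GraphIso H.1 G.1)}.ncard = V.factorial / Nat.card (GraphIso G.1 G.1) := by
  rw [← ncard_iso_mul_card_aut G, Nat.mul_div_cancel _ (card_graphIso_self_pos G.1)]

/-- kernel: in particular the labelled count of an isomorphism class on `V` vertices divides `V!`.
[cite: Balaban1983Higgs3, (1.21)–(1.22) p.416] -/
theorem ncard_iso_dvd_factorial (G : GraphOn nbar V) :
    {H : GraphOn nbar V | Nonempty (GraphIso H.1 G.1)}.ncard ∣ V.factorial :=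
  Dvd.intro _ (ncard_iso_mul_card_aut G)

/-- **The isomorphism classes of the graphs of the model on `V` vertices** («(ours)»): the quotient of the graphs with the
`V` labelled vertices by relabelling — by `mem_orbit_iff_nonempty_graphIso`, by isomorphism; a graph *"in the usual sense"*
(p. 415) with `V` vertices. [cite: Balaban1983Higgs3, p.415] -/
abbrev IsoClassOn (nbar V : ℕ) : Type := MulAction.orbitRel.Quotient (Equiv.Perm (Fin V)) (GraphOn nbar V)

/-- kernel: two labelled graphs have the same class iff they are isomorphic. [cite: Balaban1983Higgs3, p.415] -/
theorem isoClassOn_mk_eq_iff (G H : GraphOn nbar V) :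
    (Quotient.mk (MulAction.orbitRel (Equiv.Perm (Fin V)) (GraphOn nbar V)) H : IsoClassOn nbar V) =
      Quotient.mk _ G ↔ Nonempty (GraphIso H.1 G.1) := by
  rw [Quotient.eq, ← mem_orbit_iff_nonempty_graphIso]
  rfl

/-- kernel: the number of automorphisms read on a class does not depend on the representative (`card_aut_eq_of_iso`); here
for the representative `Quotient.out`. [cite: Balaban1983Higgs3, (1.21)–(1.22) p.416] -/
theorem card_aut_out_eq (G : GraphOn nbar V) :
    Nat.card (GraphIso (Quotient.mk (MulAction.orbitRel (Equiv.Perm (Fin V)) (GraphOn nbar V)) G : IsoClassOn nbar V).out.1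
      (Quotient.mk (MulAction.orbitRel (Equiv.Perm (Fin V)) (GraphOn nbar V)) G : IsoClassOn nbar V).out.1) =
      Nat.card (GraphIso G.1 G.1) := by
  obtain ⟨e⟩ := (isoClassOn_mk_eq_iff G _).mp (Quotient.out_eq _)
  exact card_aut_eq_of_iso e

/-- **Finitely many isomorphism classes on `V` vertices, given finitely many labelled graphs** (the instance
`Finite {G : Graph n̄ // G.nV = V}` is FILE 1's `B3GraphFiniteOrder.finite_graph_nV_eq`; any importer of both files has it
by instance resolution). [cite: Balaban1983Higgs3, p.415] -/
theorem finite_isoClassOn (nbar V : ℕ) [Finite (GraphOn nbar V)] : Finite (IsoClassOn nbar V) :=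
  Quotient.finite _

/-- **CLASS FORMULA for the graphs of the model** («(ours)»; the dictionary between labelled and unlabelled counting that
print's *"combinatoric factors … are a part of the graphical description"* (p. 416) leaves implicit): given finitely many
graphs on the `V` labelled vertices (FILE 1), their number is the sum over the isomorphism classes `c` of `V!/|Aut c|`
(natural-number division, exact by `card_aut_dvd_factorial`; `|Aut c|` read on the representative `c.out`, independent of
the choice by `card_aut_eq_of_iso`). [cite: Balaban1983Higgs3, p.415, (1.21)–(1.22) p.416] -/
theorem card_graphOn_eq_finsum_classes (nbar V : ℕ) [Finite (GraphOn nbar V)] :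
    Nat.card (GraphOn nbar V) =
      ∑ᶠ c : IsoClassOn nbar V, V.factorial / Nat.card (GraphIso c.out.1 c.out.1) := by
  haveI : Fintype (IsoClassOn nbar V) := Fintype.ofFinite _
  rw [finsum_eq_sum_of_fintype,
    Nat.card_congr (MulAction.selfEquivSigmaOrbits (Equiv.Perm (Fin V)) (GraphOn nbar V)), Nat.card_sigma]
  refine Finset.sum_congr rfl fun c _ => ?_
  rw [Nat.card_coe_set_eq, orbit_eq_setOf_iso, ncard_iso_eq_factorial_div]

/-- kernel: a labelled graph is fixed by the permutation `σ` iff relabelling it along `σ` gives it back.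
[cite: Balaban1983Higgs3, p.415] -/
theorem mem_fixedBy_iff (σ : Equiv.Perm (Fin V)) (G : GraphOn nbar V) :
    G ∈ MulAction.fixedBy (GraphOn nbar V) σ ↔ relabel G.1 (σ.symm.trans (finCongr G.2.symm)) = G.1 := by
  rw [MulAction.mem_fixedBy, ← smul_val]
  exact ⟨fun h => congrArg Subtype.val h, fun h => Subtype.ext h⟩

/-- **BURNSIDE'S COUNT of the isomorphism classes on `V` vertices** («(ours)»; the classical tool for counting unlabelled
graphs): `#classes · V! = Σ_σ #{labelled graphs fixed by σ}`, given finitely many labelled graphs (FILE 1).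
[cite: Balaban1983Higgs3, p.415, (1.21)–(1.22) p.416] -/
theorem card_isoClassOn_mul_factorial (nbar V : ℕ) [Finite (GraphOn nbar V)] :
    Nat.card (IsoClassOn nbar V) * V.factorial =
      ∑ σ : Equiv.Perm (Fin V), Nat.card (MulAction.fixedBy (GraphOn nbar V) σ) := by
  classical
  haveI : Fintype (GraphOn nbar V) := Fintype.ofFinite _
  haveI : Fintype (IsoClassOn nbar V) := Fintype.ofFinite _
  haveI : ∀ σ : Equiv.Perm (Fin V), Fintype (MulAction.fixedBy (GraphOn nbar V) σ) := fun _ => Fintype.ofFinite _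
  calc Nat.card (IsoClassOn nbar V) * V.factorial
      = Fintype.card (IsoClassOn nbar V) * Fintype.card (Equiv.Perm (Fin V)) := by
        rw [Nat.card_eq_fintype_card, Fintype.card_perm, Fintype.card_fin]
    _ = ∑ σ : Equiv.Perm (Fin V), Fintype.card (MulAction.fixedBy (GraphOn nbar V) σ) :=
        (MulAction.sum_card_fixedBy_eq_card_orbits_mul_card_group (Equiv.Perm (Fin V)) (GraphOn nbar V)).symm
    _ = ∑ σ : Equiv.Perm (Fin V), Nat.card (MulAction.fixedBy (GraphOn nbar V) σ) :=
        Finset.sum_congr rfl fun σ _ => Nat.card_eq_fintype_card.symm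

end Action

/-! ## §6 The same for the two-leg insertions (the letters of (1.21)) -/

section TwoLeg

variable {n V : ℕ}

/-- kernel («(ours)», plumbing): **two two-leg insertions are EQUAL** once their graphs are equal and their marked legs
correspond. [cite: Balaban1983Higgs3, (1.21) p.416] -/
theorem twoLeg_eq {T₁ T₂ : TwoLegGraph nbar} (hG : T₁.G = T₂.G) (hin : HEq T₁.legIn T₂.legIn)
    (hout : HEq T₁.legOut T₂.legOut) : T₁ = T₂ := by
  obtain ⟨G₁, i₁, o₁, _, _, _, _, _⟩ := T₁
  obtain ⟨G₂, i₂, o₂, _, _, _, _, _⟩ := T₂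
  cases hG
  cases hin
  cases hout
  rfl

/-- kernel (plumbing): the leg map along `σ` into two (propositionally) equal kind functions gives heterogeneously equal
legs. [cite: Balaban1983Higgs3, (1.17) p.415] -/
theorem legOf_heq_of_codomain_eq {n' : ℕ} {kG : Fin n → VertexKind} {kH kH' : Fin n' → VertexKind} (hk : kH = kH')
    (σ : Fin n → Fin n') (h : ∀ v, kH (σ v) = kG v) (h' : ∀ v, kH' (σ v) = kG v) (y : Leg kG) :
    HEq (legOf σ h y) (legOf σ h' y) := by
  subst hk
  rfl

/-- **The two-leg insertion `T` with its vertices RELABELLED along `σ : Fin n ≃ Fin T.G.nV`** («(ours)»): the underlying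
graph relabelled, the in-leg and the out-leg read back along `σ⁻¹`. [cite: Balaban1983Higgs3, (1.21) p.416] -/
@[reducible] def relabelTL (T : TwoLegGraph nbar) (σ : Fin n ≃ Fin T.G.nV) : TwoLegGraph nbar where
  G := relabel T.G σ
  legIn := legOf σ.symm (kG := T.G.kind) (kH := fun i => T.G.kind (σ i)) (kind_apply_symm T.G σ) T.legIn
  legOut := legOf σ.symm (kG := T.G.kind) (kH := fun i => T.G.kind (σ i)) (kind_apply_symm T.G σ) T.legOut
  in_ext := by rw [relabel_other, legOf_legOf_symm, T.in_ext, Option.map_none]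
  out_ext := by rw [relabel_other, legOf_legOf_symm, T.out_ext, Option.map_none]
  in_ne_out h := T.in_ne_out (legOf_injective σ.symm.injective _ h)
  in_scalar := by rw [isLeft_legOf, T.in_scalar]
  out_scalar := by rw [isLeft_legOf, T.out_scalar]

/-- **The relabelled insertion is isomorphic to the original**, by `σ`. [cite: Balaban1983Higgs3, (1.21) p.416] -/
def isoRelabelTL (T : TwoLegGraph nbar) (σ : Fin n ≃ Fin T.G.nV) : TwoLegGraphIso (relabelTL T σ) T where
  toGraphIso := isoRelabel T.G σ
  map_legIn := legOf_legOf_symm σ (fun _ => rfl) (kind_apply_symm T.G σ) T.legIn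
  map_legOut := legOf_legOf_symm σ (fun _ => rfl) (kind_apply_symm T.G σ) T.legOut

/-- **An isomorphism of insertions `e : T' ≅ T` IS a relabelling: `T` relabelled along `e` is `T'` itself.**
[cite: Balaban1983Higgs3, (1.21) p.416] -/
theorem relabelTL_eq_of_iso {T T' : TwoLegGraph nbar} (e : TwoLegGraphIso T' T) : relabelTL T e.toEquiv = T' := by
  have hleg : ∀ (x : Leg T'.G.kind) (y : Leg T.G.kind), legOf e.toEquiv e.kind_eq x = y →
      HEq (legOf e.toEquiv.symm (kG := T.G.kind) (kH := fun i => T.G.kind (e.toEquiv i)) (kind_apply_symm T.G e.toEquiv) y)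
        x := by
    rintro x y rfl
    exact (legOf_heq_of_codomain_eq (funext fun i => e.kind_eq i) _ _ e.kind_eq_symm _).trans
      (heq_of_eq (legOf_symm_legOf e.toEquiv e.kind_eq e.kind_eq_symm x))
  exact twoLeg_eq (relabel_eq_of_iso e.toGraphIso) (hleg _ _ e.map_legIn) (hleg _ _ e.map_legOut)

/-- kernel: relabellings of insertions compose. [cite: Balaban1983Higgs3, (1.21) p.416] -/
theorem relabelTL_relabelTL (T : TwoLegGraph nbar) (σ : Fin n ≃ Fin T.G.nV) {m : ℕ} (τ : Fin m ≃ Fin n) :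
    relabelTL (relabelTL T σ) τ = relabelTL T (τ.trans σ) := by
  have he : ((isoRelabelTL T (τ.trans σ)).trans (isoRelabelTL T σ).symm).toEquiv = τ :=
    Equiv.ext fun i => by simp [TwoLegGraphIso.trans, TwoLegGraphIso.symm, isoRelabelTL]
  have h := relabelTL_eq_of_iso ((isoRelabelTL T (τ.trans σ)).trans (isoRelabelTL T σ).symm)
  rwa [he] at h

/-- kernel: relabelling along a cast followed by an isomorphism's vertex bijection gives the isomorphic insertion back.
[cite: Balaban1983Higgs3, (1.21) p.416] -/
theorem relabelTL_finCongr_trans_iso {T T' : TwoLegGraph nbar} (e : TwoLegGraphIso T' T) (h : V = T'.G.nV) :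
    relabelTL T ((finCongr h).trans e.toEquiv) = T' := by
  subst h
  have : (finCongr (rfl : T'.G.nV = T'.G.nV)).trans e.toEquiv = e.toEquiv := Equiv.ext fun i => by simp
  rw [this]
  exact relabelTL_eq_of_iso e

/-- The two-leg insertions with exactly `V` vertices («(ours)», carrier of the action). [cite: Balaban1983Higgs3, (1.21) p.416] -/
abbrev TwoLegOn (nbar V : ℕ) : Type := {T : TwoLegGraph nbar // T.G.nV = V}

/-- **The action of the permutations of the `V` labels on the two-leg insertions with `V` vertices.**
[cite: Balaban1983Higgs3, (1.21) p.416] -/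
instance permSMulTL (nbar V : ℕ) : SMul (Equiv.Perm (Fin V)) (TwoLegOn nbar V) :=
  ⟨fun σ T => ⟨relabelTL T.1 (σ.symm.trans (finCongr T.2.symm)), rfl⟩⟩

/-- kernel: the insertion underlying `σ • T`. [cite: Balaban1983Higgs3, (1.21) p.416] -/
theorem smul_val_TL (σ : Equiv.Perm (Fin V)) (T : TwoLegOn nbar V) :
    (σ • T).1 = relabelTL T.1 (σ.symm.trans (finCongr T.2.symm)) := rfl

/-- **The permutations of the labels ACT on the two-leg insertions with `V` vertices.** [cite: Balaban1983Higgs3, (1.21) p.416] -/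
instance permMulActionTL (nbar V : ℕ) : MulAction (Equiv.Perm (Fin V)) (TwoLegOn nbar V) where
  one_smul T := by
    apply Subtype.ext
    rw [smul_val_TL]
    have h : ((1 : Equiv.Perm (Fin V)).symm.trans (finCongr T.2.symm)) = (finCongr T.2.symm).trans (TwoLegGraphIso.refl T.1).toEquiv :=
      Equiv.ext fun _ => rfl
    rw [h]
    exact relabelTL_finCongr_trans_iso (TwoLegGraphIso.refl T.1) T.2.symm
  mul_smul σ τ T := by
    apply Subtype.ext
    show relabelTL T.1 ((σ * τ).symm.trans (finCongr T.2.symm)) =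
      relabelTL (relabelTL T.1 (τ.symm.trans (finCongr T.2.symm))) (σ.symm.trans (finCongr rfl))
    rw [relabelTL_relabelTL]
    exact congrArg (relabelTL T.1) (Equiv.ext fun v => rfl)

/-- **The orbit of an insertion under relabelling is its isomorphism class.** [cite: Balaban1983Higgs3, (1.21) p.416] -/
theorem mem_orbit_iff_nonempty_twoLegGraphIso {T T' : TwoLegOn nbar V} :
    T' ∈ MulAction.orbit (Equiv.Perm (Fin V)) T ↔ Nonempty (TwoLegGraphIso T'.1 T.1) := by
  constructor
  · rintro ⟨σ, rfl⟩
    exact ⟨isoRelabelTL T.1 _⟩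
  · rintro ⟨e⟩
    refine MulAction.mem_orbit_iff.mpr ⟨((finCongr T'.2.symm).trans (e.toEquiv.trans (finCongr T.2.symm).symm)).symm, ?_⟩
    apply Subtype.ext
    rw [smul_val_TL, Equiv.symm_symm]
    have h : (((finCongr T'.2.symm).trans (e.toEquiv.trans (finCongr T.2.symm).symm)).trans (finCongr T.2.symm)) =
        (finCongr T'.2.symm).trans e.toEquiv := Equiv.ext fun v => by simp
    rw [h]
    exact relabelTL_finCongr_trans_iso e T'.2.symm

/-- kernel: set form — the orbit of `T` is the set of insertions on `V` vertices isomorphic to `T`. [cite: Balaban1983Higgs3, (1.21) p.416] -/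
theorem orbit_eq_setOf_isoTL (T : TwoLegOn nbar V) :
    (MulAction.orbit (Equiv.Perm (Fin V)) T : Set (TwoLegOn nbar V)) = {T' | Nonempty (TwoLegGraphIso T'.1 T.1)} :=
  Set.ext fun _ => mem_orbit_iff_nonempty_twoLegGraphIso

/-- **Relabelling an insertion preserves connectedness, one-particle irreducibility and the number of separating lines
between its ports** (the predicates `C_n`, `1PI` and the piece count of (1.21)–(1.22) are constant on the orbits).
[cite: Balaban1983Higgs3, (1.21)–(1.22) p.416] -/
theorem isConnected_smul_iff_TL (σ : Equiv.Perm (Fin V)) (T : TwoLegOn nbar V) :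
    B3OnePIGraphs.IsConnected (σ • T).1.G ↔ B3OnePIGraphs.IsConnected T.1.G :=
  ((isoRelabelTL T.1 (σ.symm.trans (finCongr T.2.symm))).isConnected_iff).symm

/-- kernel: relabelling an insertion preserves one-particle irreducibility. [cite: Balaban1983Higgs3, (1.21)–(1.22) p.416] -/
theorem isOnePI_smul_iff_TL (σ : Equiv.Perm (Fin V)) (T : TwoLegOn nbar V) :
    B3OnePIGraphs.IsOnePI (σ • T).1.G ↔ B3OnePIGraphs.IsOnePI T.1.G :=
  ((isoRelabelTL T.1 (σ.symm.trans (finCongr T.2.symm))).isOnePI_iff).symm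

/-- kernel: relabelling an insertion preserves the number of separating lines between the ports (the number of pieces
of (1.21)). [cite: Balaban1983Higgs3, (1.21) p.416] -/
theorem numSep_smul_TL (σ : Equiv.Perm (Fin V)) (T : TwoLegOn nbar V) :
    B3OnePIChainDecomposition.numSep (σ • T).1.G (σ • T).1.legIn.1 (σ • T).1.legOut.1 =
      B3OnePIChainDecomposition.numSep T.1.G T.1.legIn.1 T.1.legOut.1 :=
  ((isoRelabelTL T.1 (σ.symm.trans (finCongr T.2.symm))).numSep_eq).symm

/-- kernel: a permutation fixes `T` iff the corresponding relabelling of `T` is `T`. [cite: Balaban1983Higgs3, (1.21) p.416] -/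
theorem mem_stabilizer_iff_TL (T : TwoLegOn nbar V) (σ : Equiv.Perm (Fin V)) :
    σ ∈ MulAction.stabilizer (Equiv.Perm (Fin V)) T ↔ relabelTL T.1 (σ.symm.trans (finCongr T.2.symm)) = T.1 := by
  rw [MulAction.mem_stabilizer_iff, ← smul_val_TL]
  exact ⟨fun h => congrArg Subtype.val h, fun h => Subtype.ext h⟩

/-- kernel (plumbing): the vertex map of an isomorphism of insertions transported along an equality of its source.
[cite: Balaban1983Higgs3, (1.21) p.416] -/
theorem toEquiv_cast_apply_TL {A B T : TwoLegGraph nbar} (h : A = B) (e : TwoLegGraphIso A T) (v : Fin B.G.nV) :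
    (cast (congrArg (fun X => TwoLegGraphIso X T) h) e).toEquiv v = e.toEquiv (Fin.cast (congrArg (fun X => X.G.nV) h).symm v) := by
  subst h
  rfl

/-- **The automorphism of `T` defined by a permutation fixing `T`.** [cite: Balaban1983Higgs3, (1.21) p.416] -/
noncomputable def autOfStabilizerTL (T : TwoLegOn nbar V) (σ : MulAction.stabilizer (Equiv.Perm (Fin V)) T) :
    TwoLegGraphIso T.1 T.1 :=
  cast (congrArg (fun X => TwoLegGraphIso X T.1) ((mem_stabilizer_iff_TL T σ.1).mp σ.2))
    (isoRelabelTL T.1 (σ.1.symm.trans (finCongr T.2.symm)))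

/-- kernel: its vertex map is `σ⁻¹` read through the cast. [cite: Balaban1983Higgs3, (1.21) p.416] -/
theorem toEquiv_autOfStabilizerTL_apply (T : TwoLegOn nbar V) (σ : MulAction.stabilizer (Equiv.Perm (Fin V)) T)
    (v : Fin T.1.G.nV) : (autOfStabilizerTL T σ).toEquiv v = Fin.cast T.2.symm (σ.1.symm (Fin.cast T.2 v)) := by
  unfold autOfStabilizerTL
  rw [toEquiv_cast_apply_TL ((mem_stabilizer_iff_TL T σ.1).mp σ.2)]
  simp [isoRelabelTL]

/-- kernel: `autOfStabilizerTL` is injective. [cite: Balaban1983Higgs3, (1.21) p.416] -/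
theorem autOfStabilizerTL_injective (T : TwoLegOn nbar V) : Function.Injective (autOfStabilizerTL T) := by
  intro σ τ h
  apply Subtype.ext
  apply Equiv.symm_bijective.injective
  refine Equiv.ext fun w => ?_
  have hv := congrArg (fun e : TwoLegGraphIso T.1 T.1 => Fin.cast T.2 (e.toEquiv (Fin.cast T.2.symm w))) h
  simpa only [toEquiv_autOfStabilizerTL_apply, cast_cast_symm] using hv

/-- kernel: `autOfStabilizerTL` is surjective. [cite: Balaban1983Higgs3, (1.21) p.416] -/
theorem autOfStabilizerTL_surjective (T : TwoLegOn nbar V) : Function.Surjective (autOfStabilizerTL T) := by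
  intro e
  let ε : Fin V ≃ Fin T.1.G.nV := (finCongr T.2.symm).trans e.toEquiv
  let σ : Equiv.Perm (Fin V) := (ε.trans (finCongr T.2.symm).symm).symm
  have hε : σ.symm.trans (finCongr T.2.symm) = ε := Equiv.ext fun v => by simp [σ]
  have hσ : σ ∈ MulAction.stabilizer (Equiv.Perm (Fin V)) T := by
    rw [mem_stabilizer_iff_TL, hε]
    exact relabelTL_finCongr_trans_iso e T.2.symm
  refine ⟨⟨σ, hσ⟩, twoLegGraphIso_ext (graphIso_ext (Equiv.ext fun v => ?_))⟩
  show (autOfStabilizerTL T ⟨σ, hσ⟩).toEquiv v = e.toEquiv v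
  rw [toEquiv_autOfStabilizerTL_apply]
  have : σ.symm (Fin.cast T.2 v) = Fin.cast T.2 (e.toEquiv v) := by
    simp [σ, ε]
  rw [this]
  simp

/-- **The stabilizer of `T` under relabelling is in bijection with the automorphisms of `T`.** [cite: Balaban1983Higgs3, (1.21) p.416] -/
noncomputable def stabilizerEquivAutTL (T : TwoLegOn nbar V) :
    MulAction.stabilizer (Equiv.Perm (Fin V)) T ≃ TwoLegGraphIso T.1 T.1 :=
  Equiv.ofBijective (autOfStabilizerTL T) ⟨autOfStabilizerTL_injective T, autOfStabilizerTL_surjective T⟩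

/-- **The automorphisms of a two-leg insertion form a group** under composition («(ours)»; same conventions as
`autGroup`). [cite: Balaban1983Higgs3, (1.21) p.416] -/
instance autGroupTL (T : TwoLegGraph nbar) : Group (TwoLegGraphIso T T) where
  mul e e' := e'.trans e
  one := TwoLegGraphIso.refl T
  inv := TwoLegGraphIso.symm
  mul_assoc a b c := twoLegGraphIso_ext (graphIso_ext (Equiv.ext fun _ => rfl))
  one_mul a := twoLegGraphIso_ext (graphIso_ext (Equiv.ext fun _ => rfl))
  mul_one a := twoLegGraphIso_ext (graphIso_ext (Equiv.ext fun _ => rfl))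
  inv_mul_cancel a := twoLegGraphIso_ext (graphIso_ext (Equiv.ext fun v => by
    show a.toEquiv.symm (a.toEquiv v) = v
    exact a.toEquiv.symm_apply_apply v))

/-- kernel: the product of automorphisms of an insertion is composition (first the right factor).
[cite: Balaban1983Higgs3, (1.21) p.416] -/
theorem autTL_mul_def {T : TwoLegGraph nbar} (e e' : TwoLegGraphIso T T) : e * e' = e'.trans e := rfl

/-- **Forgetting the marked in-leg and out-leg is a group homomorphism `Aut T → Aut T.G`** («(ours)»): an automorphism of
an insertion is in particular an automorphism of its underlying graph. [cite: Balaban1983Higgs3, (1.21) p.416] -/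
def autTLToAut (T : TwoLegGraph nbar) : TwoLegGraphIso T T →* GraphIso T.G T.G where
  toFun := TwoLegGraphIso.toGraphIso
  map_one' := rfl
  map_mul' _ _ := rfl

/-- kernel: `autTLToAut` is injective (an automorphism of an insertion is its underlying graph automorphism).
[cite: Balaban1983Higgs3, (1.21) p.416] -/
theorem autTLToAut_injective (T : TwoLegGraph nbar) : Function.Injective (autTLToAut T) :=
  fun _ _ h => twoLegGraphIso_ext h

/-- **The symmetry number of an insertion divides that of its underlying graph**: marking the two external legs can only
reduce the symmetry. [cite: Balaban1983Higgs3, (1.21) p.416] -/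
theorem card_autTL_dvd_card_aut (T : TwoLegGraph nbar) :
    Nat.card (TwoLegGraphIso T T) ∣ Nat.card (GraphIso T.G T.G) :=
  Subgroup.card_dvd_of_injective (autTLToAut T) (autTLToAut_injective T)

/-- kernel: in particular the number of automorphisms of an insertion with `V` vertices divides `V!`.
[cite: Balaban1983Higgs3, (1.21) p.416] -/
theorem card_autTL_dvd_factorial (T : TwoLegGraph nbar) : Nat.card (TwoLegGraphIso T T) ∣ (T.G.nV).factorial :=
  (card_autTL_dvd_card_aut T).trans (card_aut_dvd_factorial T.G)

/-- kernel: the vertex bijection of a composite of isomorphisms of insertions. [cite: Balaban1983Higgs3, (1.21) p.416] -/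
@[simp] theorem toEquiv_transTL {T T' T'' : TwoLegGraph nbar} (e₁ : TwoLegGraphIso T T') (e₂ : TwoLegGraphIso T' T'') :
    (e₁.trans e₂).toEquiv = e₁.toEquiv.trans e₂.toEquiv := rfl

/-- kernel: the vertex bijection of the inverse of an isomorphism of insertions. [cite: Balaban1983Higgs3, (1.21) p.416] -/
@[simp] theorem toEquiv_symmTL {T T' : TwoLegGraph nbar} (e : TwoLegGraphIso T T') : e.symm.toEquiv = e.toEquiv.symm := rfl

/-- **Isomorphic insertions have isomorphic automorphism groups** («(ours)»): conjugation by an isomorphism of insertions.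
[cite: Balaban1983Higgs3, (1.21) p.416] -/
def autCongrTL {T T' : TwoLegGraph nbar} (e : TwoLegGraphIso T T') : TwoLegGraphIso T T ≃* TwoLegGraphIso T' T' where
  toFun a := (e.symm.trans a).trans e
  invFun b := (e.trans b).trans e.symm
  left_inv a := twoLegGraphIso_ext (graphIso_ext (Equiv.ext fun v => by simp))
  right_inv b := twoLegGraphIso_ext (graphIso_ext (Equiv.ext fun w => by simp))
  map_mul' a b := twoLegGraphIso_ext (graphIso_ext (Equiv.ext fun w => by simp [autTL_mul_def]))

/-- **The symmetry number of an insertion is an invariant of its isomorphism class.** [cite: Balaban1983Higgs3, (1.21) p.416] -/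
theorem card_autTL_eq_of_iso {T T' : TwoLegGraph nbar} (e : TwoLegGraphIso T T') :
    Nat.card (TwoLegGraphIso T T) = Nat.card (TwoLegGraphIso T' T') :=
  Nat.card_congr (autCongrTL e).toEquiv

/-- kernel: `autOfStabilizerTL` reverses products. [cite: Balaban1983Higgs3, (1.21) p.416] -/
theorem autOfStabilizerTL_mul (T : TwoLegOn nbar V) (σ τ : MulAction.stabilizer (Equiv.Perm (Fin V)) T) :
    autOfStabilizerTL T (σ * τ) = autOfStabilizerTL T τ * autOfStabilizerTL T σ := by
  refine twoLegGraphIso_ext (graphIso_ext (Equiv.ext fun v => ?_))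
  show (autOfStabilizerTL T (σ * τ)).toEquiv v =
    ((autOfStabilizerTL T σ).toGraphIso.trans (autOfStabilizerTL T τ).toGraphIso).toEquiv v
  rw [GraphIso.toEquiv_trans, Equiv.trans_apply, toEquiv_autOfStabilizerTL_apply,
    toEquiv_autOfStabilizerTL_apply, toEquiv_autOfStabilizerTL_apply, cast_cast_symm]
  simp [Equiv.Perm.mul_def]

/-- **The stabilizer of an insertion under relabelling is isomorphic, as a group, to its automorphism group.**
[cite: Balaban1983Higgs3, (1.21) p.416] -/
noncomputable def stabilizerMulEquivAutTL (T : TwoLegOn nbar V) :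
    MulAction.stabilizer (Equiv.Perm (Fin V)) T ≃* TwoLegGraphIso T.1 T.1 where
  toFun σ := (autOfStabilizerTL T σ)⁻¹
  invFun e := (stabilizerEquivAutTL T).symm e⁻¹
  left_inv σ := by
    show (stabilizerEquivAutTL T).symm ((stabilizerEquivAutTL T σ)⁻¹)⁻¹ = σ
    rw [inv_inv, Equiv.symm_apply_apply]
  right_inv e := by
    show ((stabilizerEquivAutTL T) ((stabilizerEquivAutTL T).symm e⁻¹))⁻¹ = e
    rw [Equiv.apply_symm_apply, inv_inv]
  map_mul' σ τ := by
    show (autOfStabilizerTL T (σ * τ))⁻¹ = (autOfStabilizerTL T σ)⁻¹ * (autOfStabilizerTL T τ)⁻¹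
    rw [autOfStabilizerTL_mul, mul_inv_rev]

/-- **ORBIT–STABILIZER for the two-leg insertions**: the number of insertions on the `V` labelled vertices isomorphic to
`T`, times the number of automorphisms of `T`, is `V!`. [cite: Balaban1983Higgs3, (1.21) p.416] -/
theorem ncard_isoTL_mul_card_aut (T : TwoLegOn nbar V) :
    {T' : TwoLegOn nbar V | Nonempty (TwoLegGraphIso T'.1 T.1)}.ncard * Nat.card (TwoLegGraphIso T.1 T.1) = V.factorial := by
  rw [← orbit_eq_setOf_isoTL, ← Nat.card_congr (stabilizerEquivAutTL T),
    ← MulAction.index_stabilizer (Equiv.Perm (Fin V)) T, Subgroup.index_mul_card, Nat.card_eq_fintype_card,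
    Fintype.card_perm, Fintype.card_fin]

/-- kernel: hence the labelled count of the isomorphism class of an insertion is `V! / |Aut T|`. [cite: Balaban1983Higgs3, (1.21) p.416] -/
theorem ncard_isoTL_eq_factorial_div (T : TwoLegOn nbar V) :
    {T' : TwoLegOn nbar V | Nonempty (TwoLegGraphIso T'.1 T.1)}.ncard = V.factorial / Nat.card (TwoLegGraphIso T.1 T.1) := by
  rw [← ncard_isoTL_mul_card_aut T, Nat.mul_div_cancel _ (card_twoLegGraphIso_self_pos T.1)]

/-- kernel: in particular the labelled count of an isomorphism class of insertions on `V` vertices divides `V!`.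
[cite: Balaban1983Higgs3, (1.21)–(1.22) p.416] -/
theorem ncard_isoTL_dvd_factorial (T : TwoLegOn nbar V) :
    {T' : TwoLegOn nbar V | Nonempty (TwoLegGraphIso T'.1 T.1)}.ncard ∣ V.factorial :=
  Dvd.intro _ (ncard_isoTL_mul_card_aut T)

/-- **The isomorphism classes of the two-leg insertions on `V` vertices** («(ours)»): the quotient of the insertions with
the `V` labelled vertices by relabelling (= by `TwoLegGraphIso`, `mem_orbit_iff_nonempty_twoLegGraphIso`) — the classes
in which the letters of (1.21) are read. [cite: Balaban1983Higgs3, (1.21) p.416] -/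
abbrev IsoClassOnTL (nbar V : ℕ) : Type := MulAction.orbitRel.Quotient (Equiv.Perm (Fin V)) (TwoLegOn nbar V)

/-- kernel: two labelled insertions have the same class iff they are isomorphic. [cite: Balaban1983Higgs3, (1.21) p.416] -/
theorem isoClassOnTL_mk_eq_iff (T T' : TwoLegOn nbar V) :
    (Quotient.mk (MulAction.orbitRel (Equiv.Perm (Fin V)) (TwoLegOn nbar V)) T' : IsoClassOnTL nbar V) =
      Quotient.mk _ T ↔ Nonempty (TwoLegGraphIso T'.1 T.1) := by
  rw [Quotient.eq, ← mem_orbit_iff_nonempty_twoLegGraphIso]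
  rfl

/-- kernel: the number of automorphisms read on a class of insertions does not depend on the representative.
[cite: Balaban1983Higgs3, (1.21) p.416] -/
theorem card_autTL_out_eq (T : TwoLegOn nbar V) :
    Nat.card (TwoLegGraphIso
      (Quotient.mk (MulAction.orbitRel (Equiv.Perm (Fin V)) (TwoLegOn nbar V)) T : IsoClassOnTL nbar V).out.1
      (Quotient.mk (MulAction.orbitRel (Equiv.Perm (Fin V)) (TwoLegOn nbar V)) T : IsoClassOnTL nbar V).out.1) =
      Nat.card (TwoLegGraphIso T.1 T.1) := by
  obtain ⟨e⟩ := (isoClassOnTL_mk_eq_iff T _).mp (Quotient.out_eq _)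
  exact card_autTL_eq_of_iso e

/-- **Finitely many isomorphism classes of insertions on `V` vertices, given finitely many labelled insertions** (the
instance `Finite {T : TwoLegGraph n̄ // T.G.nV = V}` is FILE 1's `B3GraphFiniteOrder.finite_twoLeg_nV_eq`).
[cite: Balaban1983Higgs3, (1.21) p.416] -/
theorem finite_isoClassOnTL (nbar V : ℕ) [Finite (TwoLegOn nbar V)] : Finite (IsoClassOnTL nbar V) :=
  Quotient.finite _

/-- **CLASS FORMULA for the two-leg insertions** («(ours)»): given finitely many insertions on the `V` labelled vertices
(FILE 1), their number is the sum over the isomorphism classes `c` of `V!/|Aut c|` (exact division,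
`card_autTL_dvd_factorial`). [cite: Balaban1983Higgs3, (1.21)–(1.22) p.416] -/
theorem card_twoLegOn_eq_finsum_classes (nbar V : ℕ) [Finite (TwoLegOn nbar V)] :
    Nat.card (TwoLegOn nbar V) =
      ∑ᶠ c : IsoClassOnTL nbar V, V.factorial / Nat.card (TwoLegGraphIso c.out.1 c.out.1) := by
  haveI : Fintype (IsoClassOnTL nbar V) := Fintype.ofFinite _
  rw [finsum_eq_sum_of_fintype,
    Nat.card_congr (MulAction.selfEquivSigmaOrbits (Equiv.Perm (Fin V)) (TwoLegOn nbar V)), Nat.card_sigma]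
  refine Finset.sum_congr rfl fun c _ => ?_
  rw [Nat.card_coe_set_eq, orbit_eq_setOf_isoTL, ncard_isoTL_eq_factorial_div]

/-- kernel: a labelled insertion is fixed by the permutation `σ` iff relabelling it along `σ` gives it back.
[cite: Balaban1983Higgs3, (1.21) p.416] -/
theorem mem_fixedBy_iff_TL (σ : Equiv.Perm (Fin V)) (T : TwoLegOn nbar V) :
    T ∈ MulAction.fixedBy (TwoLegOn nbar V) σ ↔ relabelTL T.1 (σ.symm.trans (finCongr T.2.symm)) = T.1 := by
  rw [MulAction.mem_fixedBy, ← smul_val_TL]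
  exact ⟨fun h => congrArg Subtype.val h, fun h => Subtype.ext h⟩

/-- **BURNSIDE'S COUNT of the isomorphism classes of insertions on `V` vertices** («(ours)»):
`#classes · V! = Σ_σ #{labelled insertions fixed by σ}`, given finitely many labelled insertions (FILE 1).
[cite: Balaban1983Higgs3, (1.21)–(1.22) p.416] -/
theorem card_isoClassOnTL_mul_factorial (nbar V : ℕ) [Finite (TwoLegOn nbar V)] :
    Nat.card (IsoClassOnTL nbar V) * V.factorial =
      ∑ σ : Equiv.Perm (Fin V), Nat.card (MulAction.fixedBy (TwoLegOn nbar V) σ) := by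
  classical
  haveI : Fintype (TwoLegOn nbar V) := Fintype.ofFinite _
  haveI : Fintype (IsoClassOnTL nbar V) := Fintype.ofFinite _
  haveI : ∀ σ : Equiv.Perm (Fin V), Fintype (MulAction.fixedBy (TwoLegOn nbar V) σ) := fun _ => Fintype.ofFinite _
  calc Nat.card (IsoClassOnTL nbar V) * V.factorial
      = Fintype.card (IsoClassOnTL nbar V) * Fintype.card (Equiv.Perm (Fin V)) := by
        rw [Nat.card_eq_fintype_card, Fintype.card_perm, Fintype.card_fin]
    _ = ∑ σ : Equiv.Perm (Fin V), Fintype.card (MulAction.fixedBy (TwoLegOn nbar V) σ) :=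
        (MulAction.sum_card_fixedBy_eq_card_orbits_mul_card_group (Equiv.Perm (Fin V)) (TwoLegOn nbar V)).symm
    _ = ∑ σ : Equiv.Perm (Fin V), Nat.card (MulAction.fixedBy (TwoLegOn nbar V) σ) :=
        Finset.sum_congr rfl fun σ _ => Nat.card_eq_fintype_card.symm

end TwoLeg

end Literature.MathematicalPhysics.QuantumFieldTheory.Balaban1983to89.B3GraphRelabelling
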